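import Mathlib

/-!
# Isotypic decomposition of a representation of a finite abelian group by character projectors
(kernel witness for the finite-group core of the standard fact (A1))

Blind cell `pub-hodge-repro2`, seat p4, Tier-5 support. README §8(d): this file uses an
L-value-free non-vanishing device: NO (it is a kernel check of a standard fact already on the
cell's record).

The standard fact (A1) of `route/T5-route-2.md` §N5.11.7 (owner route-2, sub-step N5), used in
Lemma N5.L3 / Corollary N5.L3′, reads in its representation-theoretic part: «a smooth representation
of a compact totally disconnected group is the direct sum of its isotypic components `ω[α]` (the
images of the idempotents `e_α = ∫ α⁻¹(g) ω(g) dg`, Haar probability measure), and the maximal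
`α`-isotypic quotient is `ω[α]`». On the vectors fixed by an open normal subgroup `K` this is a
statement about the finite abelian quotient `E¹_v / K`; the finite-group statement is what we
kernel-check here, for an arbitrary (not necessarily finite-dimensional) complex representation.

Setting: `A` a finite abelian group (written additively), `ρ : Representation ℂ (Multiplicative A) V`
a representation on a complex vector space `V` of any dimension, characters `α : AddChar A ℂ`
(Mathlib's additive characters; the dual group, `AddChar.card_eq`).

* `isotypic ρ α` — the `α`-isotypic subspace `{v | ∀ a, ρ a v = α a • v}`;
* `proj ρ α = |A|⁻¹ • ∑ a, (α a)⁻¹ • ρ a` — the character projector `e_α`;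
* `proj_apply_of_mem` (`e_α = 1` on `V[α]`), `proj_mem_isotypic` (`e_α V ⊆ V[α]`), hence
  `range_proj` (`e_α V = V[α]`) and `proj_proj` (`e_α` idempotent);
* `proj_apply_of_mem_of_ne` (`e_α = 0` on `V[β]`, `β ≠ α`), hence `proj_proj_of_ne` (orthogonality);
* `sum_proj` (`∑_α e_α = 1`, from the dual orthogonality `AddChar.sum_apply_eq_ite`);
* **`isInternal_isotypic`** — `V = ⨁_α V[α]` (Mathlib's `DirectSum.IsInternal`);
* `eq_zero_of_mem_isotypic_of_ne` — an `α`-equivariant linear map out of `V` kills every `V[β]`,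
  `β ≠ α` (the «maximal `α`-isotypic quotient is `V[α]`» half).

Mathlib only; no sorry; axioms ⊆ {propext, Classical.choice, Quot.sound}.
-/

namespace Summit.Ventures.HodgeRepro2.T5CharacterProjectors

open Multiplicative

variable {A : Type*} [AddCommGroup A]
variable {V : Type*} [AddCommGroup V] [Module ℂ V]

/-- The `α`-isotypic subspace of a representation `ρ` of the finite abelian group `A`:
the vectors on which every `ρ a` acts by the scalar `α a`. -/
def isotypic (ρ : Representation ℂ (Multiplicative A) V) (α : AddChar A ℂ) : Submodule ℂ V where
  carrier := {v | ∀ a : A, ρ (ofAdd a) v = α a • v}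
  zero_mem' := by intro a; simp
  add_mem' := by
    intro v w hv hw a
    simp only [Set.mem_setOf_eq] at hv hw
    rw [map_add, hv a, hw a, smul_add]
  smul_mem' := by
    intro c v hv a
    simp only [Set.mem_setOf_eq] at hv
    rw [map_smul, hv a, smul_comm]

/-- Membership in the isotypic subspace. -/
theorem mem_isotypic {ρ : Representation ℂ (Multiplicative A) V} {α : AddChar A ℂ} {v : V} :
    v ∈ isotypic ρ α ↔ ∀ a : A, ρ (ofAdd a) v = α a • v := Iff.rfl

/-- The «maximal `α`-isotypic quotient» half: a linear map `f : V → W` on which `A` acts through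
`α` (`f (ρ a v) = α a • f v`) vanishes on every `V[β]` with `β ≠ α`; hence it factors through the
projection `e_α : V → V[α]`. -/
theorem eq_zero_of_mem_isotypic_of_ne {W : Type*} [AddCommGroup W] [Module ℂ W]
    (ρ : Representation ℂ (Multiplicative A) V) {α β : AddChar A ℂ} (hne : β ≠ α)
    (f : V →ₗ[ℂ] W) (hf : ∀ (a : A) (v : V), f (ρ (ofAdd a) v) = α a • f v) {v : V}
    (hv : v ∈ isotypic ρ β) : f v = 0 := by
  obtain ⟨a, ha⟩ := DFunLike.ne_iff.mp hne
  have h1 : f (ρ (ofAdd a) v) = β a • f v := by rw [hv a, map_smul]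
  have h2 : (β a - α a) • f v = 0 := by rw [sub_smul, ← h1, hf a v, sub_self]
  exact (smul_eq_zero.mp h2).resolve_left (sub_ne_zero.mpr ha)

/-- A character of a group takes non-zero values. -/
theorem apply_ne_zero (α : AddChar A ℂ) (a : A) : α a ≠ 0 :=
  (AddChar.val_isUnit α a).ne_zero

section Finite

variable [Fintype A]

/-- The character projector `e_α = |A|⁻¹ • ∑_a (α a)⁻¹ • ρ a`. -/
noncomputable def proj (ρ : Representation ℂ (Multiplicative A) V) (α : AddChar A ℂ) :
    V →ₗ[ℂ] V :=
  (Fintype.card A : ℂ)⁻¹ • ∑ a : A, (α a)⁻¹ • ρ (ofAdd a)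

/-- `e_α v = |A|⁻¹ • ∑_a (α a)⁻¹ • ρ a v`. -/
theorem proj_apply (ρ : Representation ℂ (Multiplicative A) V) (α : AddChar A ℂ) (v : V) :
    proj ρ α v = (Fintype.card A : ℂ)⁻¹ • ∑ a : A, (α a)⁻¹ • ρ (ofAdd a) v := by
  simp only [proj, LinearMap.smul_apply, LinearMap.sum_apply]

/-- The cardinality of `A` is a non-zero complex number. -/
theorem card_ne_zero : (Fintype.card A : ℂ) ≠ 0 :=
  Nat.cast_ne_zero.mpr Fintype.card_ne_zero

/-- `ρ b ∘ e_α = α b • e_α`: the image of the projector is `α`-isotypic (reindexing the sum by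
`a ↦ b + a`). -/
theorem rho_proj (ρ : Representation ℂ (Multiplicative A) V) (α : AddChar A ℂ) (b : A) (v : V) :
    ρ (ofAdd b) (proj ρ α v) = α b • proj ρ α v := by
  rw [proj_apply, map_smul, map_sum, smul_comm (α b)]
  congr 1
  rw [Finset.smul_sum]
  refine (Fintype.sum_equiv (Equiv.addLeft b)
    (fun a : A => ρ (ofAdd b) ((α a)⁻¹ • ρ (ofAdd a) v))
    (fun a : A => (α (a - b))⁻¹ • ρ (ofAdd a) v) fun a => ?_).trans ?_
  · show ρ (ofAdd b) ((α a)⁻¹ • ρ (ofAdd a) v) = (α (b + a - b))⁻¹ • ρ (ofAdd (b + a)) v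
    rw [map_smul, add_sub_cancel_left, ofAdd_add, map_mul, Module.End.mul_apply]
  · refine Finset.sum_congr rfl fun a _ => ?_
    rw [AddChar.map_sub_eq_div, inv_div, div_eq_mul_inv, mul_comm, mul_smul, smul_comm]

/-- `e_α v ∈ V[α]`. -/
theorem proj_mem_isotypic (ρ : Representation ℂ (Multiplicative A) V) (α : AddChar A ℂ) (v : V) :
    proj ρ α v ∈ isotypic ρ α :=
  fun b => rho_proj ρ α b v

/-- `e_α = 1` on `V[α]`. -/
theorem proj_apply_of_mem (ρ : Representation ℂ (Multiplicative A) V) (α : AddChar A ℂ) {v : V}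
    (hv : v ∈ isotypic ρ α) : proj ρ α v = v := by
  rw [proj_apply]
  have : ∀ a : A, (α a)⁻¹ • ρ (ofAdd a) v = v := by
    intro a
    rw [hv a, smul_smul, inv_mul_cancel₀ (apply_ne_zero α a), one_smul]
  simp_rw [this]
  rw [Finset.sum_const, Finset.card_univ, ← Nat.cast_smul_eq_nsmul ℂ, smul_smul,
    inv_mul_cancel₀ card_ne_zero, one_smul]

/-- `e_α = 0` on `V[β]` for `β ≠ α` (orthogonality of distinct characters, `AddChar.sum_eq_ite`). -/
theorem proj_apply_of_mem_of_ne (ρ : Representation ℂ (Multiplicative A) V) {α β : AddChar A ℂ}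
    (hne : β ≠ α) {v : V} (hv : v ∈ isotypic ρ β) : proj ρ α v = 0 := by
  rw [proj_apply]
  have : ∀ a : A, (α a)⁻¹ • ρ (ofAdd a) v = (β - α) a • v := by
    intro a
    rw [hv a, smul_smul, AddChar.sub_apply, AddChar.map_neg_eq_inv, mul_comm]
  simp_rw [this]
  rw [← Finset.sum_smul, AddChar.sum_eq_zero_iff_ne_zero.mpr (sub_ne_zero.mpr hne), zero_smul,
    smul_zero]

/-- The range of `e_α` is exactly `V[α]`. -/
theorem range_proj (ρ : Representation ℂ (Multiplicative A) V) (α : AddChar A ℂ) :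
    LinearMap.range (proj ρ α) = isotypic ρ α := by
  ext v
  constructor
  · rintro ⟨w, rfl⟩
    exact proj_mem_isotypic ρ α w
  · intro hv
    exact ⟨v, proj_apply_of_mem ρ α hv⟩

/-- `e_α` is idempotent. -/
theorem proj_proj (ρ : Representation ℂ (Multiplicative A) V) (α : AddChar A ℂ) (v : V) :
    proj ρ α (proj ρ α v) = proj ρ α v :=
  proj_apply_of_mem ρ α (proj_mem_isotypic ρ α v)

/-- `e_α ∘ e_β = 0` for `β ≠ α`. -/
theorem proj_proj_of_ne (ρ : Representation ℂ (Multiplicative A) V) {α β : AddChar A ℂ}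
    (hne : β ≠ α) (v : V) : proj ρ α (proj ρ β v) = 0 :=
  proj_apply_of_mem_of_ne ρ hne (proj_mem_isotypic ρ β v)

/-- The isotypic subspaces are independent: `V[α]` meets the span of the other `V[β]` trivially. -/
theorem iSupIndep_isotypic (ρ : Representation ℂ (Multiplicative A) V) :
    iSupIndep fun α : AddChar A ℂ => isotypic ρ α := by
  rw [iSupIndep_def]
  intro α
  rw [Submodule.disjoint_def]
  intro v hv hv'
  -- the other isotypic spaces lie in the kernel of `e_α`
  have hker : (⨆ (β : AddChar A ℂ) (_ : β ≠ α), isotypic ρ β) ≤ LinearMap.ker (proj ρ α) := by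
    refine iSup_le fun β => iSup_le fun hβ w hw => ?_
    rw [LinearMap.mem_ker]
    exact proj_apply_of_mem_of_ne ρ hβ hw
  have h0 : proj ρ α v = 0 := LinearMap.mem_ker.mp (hker hv')
  rw [← proj_apply_of_mem ρ α hv, h0]

variable [DecidableEq A]

/-- `∑_α e_α = 1` (dual orthogonality `∑_α α(-a) = |A|·[a = 0]`, `AddChar.sum_apply_eq_ite`). -/
theorem sum_proj (ρ : Representation ℂ (Multiplicative A) V) (v : V) :
    ∑ α : AddChar A ℂ, proj ρ α v = v := by
  simp_rw [proj_apply]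
  rw [← Finset.smul_sum, Finset.sum_comm]
  have : ∀ a : A, ∑ α : AddChar A ℂ, (α a)⁻¹ • ρ (ofAdd a) v =
      (if a = 0 then (Fintype.card A : ℂ) else 0) • ρ (ofAdd a) v := by
    intro a
    rw [← Finset.sum_smul]
    congr 1
    have h := AddChar.sum_apply_eq_ite (α := A) (-a)
    simp only [neg_eq_zero] at h
    rw [← h]
    exact Finset.sum_congr rfl fun α _ => (AddChar.map_neg_eq_inv α a).symm
  simp_rw [this, ite_smul, zero_smul]
  rw [Finset.sum_ite_eq' Finset.univ (0 : A)]
  simp only [Finset.mem_univ, if_true, ofAdd_zero, map_one, Module.End.one_apply, smul_smul,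
    inv_mul_cancel₀ card_ne_zero, one_smul]

/-- Every vector is the sum of its isotypic components: `v = ∑_α e_α v`, `e_α v ∈ V[α]`. -/
theorem mem_iSup_isotypic (ρ : Representation ℂ (Multiplicative A) V) (v : V) :
    v ∈ ⨆ α : AddChar A ℂ, isotypic ρ α := by
  rw [← sum_proj ρ v]
  exact Submodule.sum_mem _ fun α _ => Submodule.mem_iSup_of_mem α (proj_mem_isotypic ρ α v)

/-- The isotypic subspaces generate `V`. -/
theorem iSup_isotypic_eq_top (ρ : Representation ℂ (Multiplicative A) V) :
    ⨆ α : AddChar A ℂ, isotypic ρ α = ⊤ :=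
  eq_top_iff.mpr fun v _ => mem_iSup_isotypic ρ v

/-- THE STANDARD FACT (A1), finite-group core: a complex representation (of any dimension) of a
finite abelian group is the internal direct sum of its isotypic subspaces `V[α]`, `α` running over
the characters of the group. -/
theorem isInternal_isotypic (ρ : Representation ℂ (Multiplicative A) V) :
    DirectSum.IsInternal fun α : AddChar A ℂ => isotypic ρ α :=
  DirectSum.isInternal_submodule_of_iSupIndep_of_iSup_eq_top (iSupIndep_isotypic ρ)
    (iSup_isotypic_eq_top ρ)

/-- Consequently such an `f` is determined by its restriction to `V[α]`: `f v = f (e_α v)`. -/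
theorem apply_eq_apply_proj {W : Type*} [AddCommGroup W] [Module ℂ W]
    (ρ : Representation ℂ (Multiplicative A) V) (α : AddChar A ℂ)
    (f : V →ₗ[ℂ] W) (hf : ∀ (a : A) (v : V), f (ρ (ofAdd a) v) = α a • f v) (v : V) :
    f v = f (proj ρ α v) := by
  conv_lhs => rw [← sum_proj ρ v]
  rw [map_sum, Finset.sum_eq_single α]
  · intro β _ hβ
    exact eq_zero_of_mem_isotypic_of_ne ρ hβ f hf (proj_mem_isotypic ρ β v)
  · intro h
    exact absurd (Finset.mem_univ α) h

end Finite

end Summit.Ventures.HodgeRepro2.T5CharacterProjectors
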